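import Mathlib
import Literature.MathematicalPhysics.QuantumFieldTheory.Balaban1983to89.Beta.VectorTailsBlock
import Literature.MathematicalPhysics.QuantumFieldTheory.Balaban1983to89.Beta.VectorTailsWindow
import Literature.MathematicalPhysics.QuantumFieldTheory.Balaban1983to89.Beta.WallVolumeTransfer

/-!
# The vector small-field legs AT THE VOLUME SEAM — by-name compositions (β sub-cell, row an1)

HONEST FRAMING (verbatim, p. 1 of everything in this cell): discharging `BetaPertH` makes
Bałaban's UV stability UNCONDITIONAL — a real constructive-QFT result; it is NOT the continuum
limit and NOT the Clay problem.  ABSOLUTE RULE: no internally-minted statement enters as a cited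
fact; every hypothesis below is either kernel-proved in this package or a NAMED binder
(`B5.Prop12Printed`, `B5.Kernel126_127Printed` — the printed Prop. 1.2 / (1.126)–(1.127) shapes,
passed BY NAME and never discharged here).  This file proves NO estimate: every declaration is a
composition BY NAME of theorems already in the tree / in this chain.  All tags `[folklore]`;
zero cited facts; no `sorry`.

WHAT IS COMPOSED.  The an4 seam `Beta/WallVolumeTransfer` (§Avg, §EndToEnd) transfers the EIGHT
torus-side graded rows `h0T/h1T/h1×T/h2×T/d0T/d1T/d1×T/d2×T` of a kernel family `GT n b t v`
(UNIFORM in the volume `t`) to the `ℤ⁴` rows of the average-first scalar wall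
(`SquareTableAvgFirst`) through the pointwise volume limits `hG`/`hg`, and feeds the wall's
end-to-end theorem.  For the VECTOR road the family is `GT := VectorTailsPt.GT Mv a ha X₀ kk nn φ`
(the reading `n² · φ (𝒢 ((x₀ + v, κ), (x₀, ν₀)))` of the small-field propagator `𝒢 = Δ_a⁻¹` on
the fine torus of the volume), and this chain supplies:
* the four `d`-rows — `VectorTailsPt.wall_rows_mod` (modulo the printed Props, by name);
* the four `h`-rows — `VectorTailsWindow.hRows_of_gamma`: they FOLLOW from the same four rows for
  the scalar Γ-part `GS` (the scalar suppliers' business, kept as hypotheses `h0S … h2xS` here),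
  the longitudinal remainder being closed by `LongitudinalWindow` (K0)–(K2), constants
  `Dvec D a = D + lAdd a`.
§1 states the two compositions and the END-TO-END composition for ANY instance (base-point type
`κB`, blocks `Bset`, shift `sh`, instance map `X₀`, component maps `kk nn`, functional `φ`) under
the wrapped-shift hypotheses hX-mod / hk / hν of `wall_rows_mod` and the consumer's `hshB`;
§2 discharges the instance hypotheses for the LABELLED CYCLIC BLOCK INSTANCE of
`Beta/VectorTailsBlock` (`lblock`, `lshift`, `X₀L`); §3 adds UNIFORM WEIGHTS on the labelled
block, discharging the wall's three weight binders as well.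

WHAT REMAINS A BINDER (other rows' work, never minted here): the printed Props (h12, h126), the
growth of the volumes (hgrow), the pointwise volume limits hG / hg (an4 `EntrywiseVolumeLimit` /
an5), the Γ-part free-comparison rows with constants `D` (scalar suppliers), and the wall's
one-loop data (hgen, S, hμν, hN, hL, hc/hM/hML, hU, hid, hrem, hr, hβ', hcont, hup) exactly as in
`WallVolumeTransfer.endpointExistence_of_scalarBounds_avgFirst_vol`.  NOT summit progress.
-/

namespace Literature.MathematicalPhysics.QuantumFieldTheory.Balaban1983to89.Beta.VectorTailsSeam

open _root_.Filter
open scoped _root_.Topology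
open Literature.MathematicalPhysics.QuantumFieldTheory.Balaban1983to89
open Literature.MathematicalPhysics.QuantumFieldTheory.Balaban1983to89.Beta
open Literature.MathematicalPhysics.QuantumFieldTheory.Balaban1983to89.B5Prop11Plancherel (Tor fine)
open Literature.MathematicalPhysics.QuantumFieldTheory.Balaban1983to89.Beta.DyadicShell (Pt supNorm)
open Literature.MathematicalPhysics.QuantumFieldTheory.Balaban1983to89.Beta.BubbleTransfer (unitVec)
open Literature.MathematicalPhysics.QuantumFieldTheory.Balaban1983to89.Beta.GhostTable (gFree)
open Literature.MathematicalPhysics.QuantumFieldTheory.Balaban1983to89.Beta.VectorTailsLoc (fam kfam)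
open Literature.MathematicalPhysics.QuantumFieldTheory.Balaban1983to89.Beta.VectorTailsPt
  (GT blockSteps wall_rows_mod)
open Literature.MathematicalPhysics.QuantumFieldTheory.Balaban1983to89.Beta.VectorTailsBlock
  (X₀L lblock lshift lshift_mem_lblock_iff lwrapped_hX lblock_card lblock_nonempty)
open Literature.MathematicalPhysics.QuantumFieldTheory.Balaban1983to89.Beta.VectorTailsWindow
  (GS Dvec Dvec_nonneg hRows_of_gamma)
open Literature.MathematicalPhysics.QuantumFieldTheory.Balaban1983to89.Beta.WallVolumeTransfer
  (d0_avg_vol d1_avg_vol d1x_vol d2x_vol h0_avg_vol h1_avg_vol h1x_vol h2x_vol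
    endpointExistence_of_scalarBounds_avgFirst_vol)
open FlowStep DagBinding
open Literature.MathematicalPhysics.QuantumFieldTheory.Balaban1983to89.Beta.MarginalTelescoping
  (composedCoeff IdentityForm)
open Literature.MathematicalPhysics.QuantumFieldTheory.Balaban1983to89.Beta.RemainderChain
  (RemainderConst)
open Literature.MathematicalPhysics.QuantumFieldTheory.Balaban1983to89.Beta.WindowIdentification
  (fullSum)
open Literature.MathematicalPhysics.QuantumFieldTheory.Balaban1983to89.Beta.SquareTable (stK)

/-! ## §1 Any instance -/

section Generic

variable {τ : Type} {κB : Type*} (Mv : ℕ+ × τ → Fin 4 → ℕ) [hMv : ∀ i ρ, NeZero (Mv i ρ)]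
  (a : ℝ) (ha : 0 < a)

/-- **THE FOUR VOLUME-SIDE `d`-ROWS OF THE WALL FOR THE VECTOR LEGS** (any instance):
`VectorTailsPt.wall_rows_mod` (torus side, uniform in the volume, modulo the printed Props by
name) composed with the an4 seam `d0_avg_vol` / `d1_avg_vol` / `d1x_vol` / `d2x_vol`.
[folklore] -/
theorem dRows_vol
    (h12 : B5.Prop12Printed (fam (fun i : ℕ+ × τ => ((i.1 : ℕ+) : ℕ)) (fun i => i.1.pos) Mv a ha))
    (h126 : B5.Kernel126_127Printed (kfam (fun i : ℕ+ × τ => ((i.1 : ℕ+) : ℕ)) Mv))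
    {l : Filter τ} [l.NeBot]
    (hgrow : ∀ (m : ℕ+) (ρ : Fin 4), Tendsto (fun t => (m : ℕ) * Mv (m, t) ρ) l atTop)
    (X₀ : (i : ℕ+ × τ) → κB → Tor (fine ((i.1 : ℕ+) : ℕ) (Mv i))) (kk nn : ℕ → κB → Fin 4)
    (φ : ℂ →+ ℝ) (hφ : ∀ z, |φ z| ≤ ‖z‖) (Bset : ℕ → Finset κB) (sh : ℕ → Equiv.Perm κB)
    (μ ν : Fin 4)
    (hX : ∀ (m : ℕ+) (t : τ), ∀ b ∈ Bset m,
      X₀ (m, t) (sh m b) - (X₀ (m, t) b + B5Prop11Plancherel.unitVec (fine (m : ℕ) (Mv (m, t))) μ)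
        ∈ blockSteps (m : ℕ) (Mv (m, t)))
    (hk : ∀ m : ℕ, ∀ b ∈ Bset m, kk m (sh m b) = kk m b)
    (hν : ∀ m : ℕ, ∀ b ∈ Bset m, nn m (sh m b) = nn m b)
    (hshB : ∀ n : ℕ, 2 ≤ n → ∀ b, sh n b ∈ Bset n ↔ b ∈ Bset n)
    (Gf : ℕ → κB → Pt → ℝ)
    (hG : ∀ n : ℕ, 2 ≤ n → ∀ b ∈ Bset n, ∀ v,
      Tendsto (fun t => GT Mv a ha X₀ kk nn φ n b t v) l (𝓝 (Gf n b v))) :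
    ∃ (δ : ℝ) (A : ℕ → ℝ), 0 < δ ∧ (∀ j, 0 ≤ A j) ∧
      (∀ n : ℕ, 2 ≤ n → ∀ b ∈ Bset n, ∀ v : Pt, v ≠ 0 →
        |Gf n b v| ≤ A 0 * Real.exp (-(δ / n) * supNorm v) / (supNorm v : ℝ) ^ 2) ∧
      (∀ n : ℕ, 2 ≤ n → ∀ b ∈ Bset n, ∀ v : Pt, v ≠ 0 → ∀ ρ : Fin 4,
        |Gf n b (v + unitVec ρ) - Gf n b v| ≤
          A 1 * Real.exp (-(δ / n) * supNorm v) / (supNorm v : ℝ) ^ 3) ∧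
      (∀ n : ℕ, 2 ≤ n → ∀ b ∈ Bset n, ∀ v : Pt, v ≠ 0 →
        |Gf n (sh n b) v - Gf n b v| ≤
          A 3 * Real.exp (-(δ / n) * supNorm v) / (supNorm v : ℝ) ^ 3) ∧
      (∀ n : ℕ, 2 ≤ n → ∀ b ∈ Bset n, ∀ v : Pt, v ≠ 0 →
        |Gf n b (v + unitVec μ + unitVec ν) - Gf n b (v + unitVec μ) -
            (Gf n (sh n b) (v + unitVec ν) - Gf n (sh n b) v)| ≤
          A 2 * Real.exp (-(δ / n) * supNorm v) / (supNorm v : ℝ) ^ 4) := by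
  obtain ⟨δ, A, hδ, hA, d0T, d1T, d1xT, d2xT⟩ :=
    wall_rows_mod Mv a ha h12 h126 hgrow X₀ kk nn φ hφ Bset sh (μ := μ) (ν := ν) hX hk hν
  exact ⟨δ, A, hδ, hA, d0_avg_vol hG d0T, d1_avg_vol hG d1T, d1x_vol hshB hG d1xT,
    d2x_vol hshB hG d2xT⟩

/-- **THE FOUR VOLUME-SIDE FREE-COMPARISON `h`-ROWS OF THE WALL FOR THE VECTOR LEGS** (any
instance): `VectorTailsWindow.hRows_of_gamma` (torus side: the rows for `GT` follow from the same
rows for the Γ-part `GS`, constants `Dvec D a`) composed with the an4 seam `h0_avg_vol` /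
`h1_avg_vol` / `h1x_vol` / `h2x_vol`.  [folklore] -/
theorem hRows_vol
    (X₀ : (i : ℕ+ × τ) → κB → Tor (fine ((i.1 : ℕ+) : ℕ) (Mv i))) (kk nn : ℕ → κB → Fin 4)
    (φ : ℂ →+ ℝ) (hφ : ∀ z, |φ z| ≤ ‖z‖) (Bset : ℕ → Finset κB) (sh : ℕ → Equiv.Perm κB)
    (μ ν : Fin 4)
    (hX : ∀ (m : ℕ+) (t : τ), ∀ b ∈ Bset m,
      X₀ (m, t) (sh m b) - (X₀ (m, t) b + B5Prop11Plancherel.unitVec (fine (m : ℕ) (Mv (m, t))) μ)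
        ∈ blockSteps (m : ℕ) (Mv (m, t)))
    (hk : ∀ m : ℕ, ∀ b ∈ Bset m, kk m (sh m b) = kk m b)
    (hν : ∀ m : ℕ, ∀ b ∈ Bset m, nn m (sh m b) = nn m b)
    (hshB : ∀ n : ℕ, 2 ≤ n → ∀ b, sh n b ∈ Bset n ↔ b ∈ Bset n)
    {l : Filter τ} [l.NeBot] (gT : ℕ → κB → τ → Pt → ℝ) (Gf : ℕ → κB → Pt → ℝ) (D : ℕ → ℝ)
    (hG : ∀ n : ℕ, 2 ≤ n → ∀ b ∈ Bset n, ∀ v,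
      Tendsto (fun t => GT Mv a ha X₀ kk nn φ n b t v) l (𝓝 (Gf n b v)))
    (hg : ∀ n : ℕ, 2 ≤ n → ∀ b ∈ Bset n, ∀ v, Tendsto (fun t => gT n b t v) l (𝓝 (gFree v)))
    (h0S : ∀ n : ℕ, 2 ≤ n → ∀ b ∈ Bset n, ∀ v, ∀ᶠ t in l,
      |GS Mv a X₀ kk nn φ n b t v - gT n b t v| ≤ D 0 / (n : ℝ) ^ 2)
    (h1S : ∀ n : ℕ, 2 ≤ n → ∀ b ∈ Bset n, ∀ v (ρ : Fin 4), ∀ᶠ t in l,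
      |(GS Mv a X₀ kk nn φ n b t (v + unitVec ρ) - gT n b t (v + unitVec ρ))
          - (GS Mv a X₀ kk nn φ n b t v - gT n b t v)| ≤ D 1 / (n : ℝ) ^ 3)
    (h1xS : ∀ n : ℕ, 2 ≤ n → ∀ b ∈ Bset n, ∀ v, ∀ᶠ t in l,
      |GS Mv a X₀ kk nn φ n (sh n b) t v - GS Mv a X₀ kk nn φ n b t v| ≤ D 3 / (n : ℝ) ^ 3)
    (h2xS : ∀ n : ℕ, 2 ≤ n → ∀ b ∈ Bset n, ∀ v, ∀ᶠ t in l,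
      |(GS Mv a X₀ kk nn φ n b t (v + unitVec μ + unitVec ν) - gT n b t (v + unitVec μ + unitVec ν))
          - (GS Mv a X₀ kk nn φ n b t (v + unitVec μ) - gT n b t (v + unitVec μ))
          - ((GS Mv a X₀ kk nn φ n (sh n b) t (v + unitVec ν) - gT n (sh n b) t (v + unitVec ν))
            - (GS Mv a X₀ kk nn φ n (sh n b) t v - gT n (sh n b) t v))| ≤ D 2 / (n : ℝ) ^ 4) :
    (∀ n : ℕ, 2 ≤ n → ∀ b ∈ Bset n, ∀ v, |Gf n b v - gFree v| ≤ Dvec D a 0 / (n : ℝ) ^ 2) ∧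
    (∀ n : ℕ, 2 ≤ n → ∀ b ∈ Bset n, ∀ v (ρ : Fin 4),
      |(Gf n b (v + unitVec ρ) - gFree (v + unitVec ρ)) - (Gf n b v - gFree v)|
        ≤ Dvec D a 1 / (n : ℝ) ^ 3) ∧
    (∀ n : ℕ, 2 ≤ n → ∀ b ∈ Bset n, ∀ v, |Gf n (sh n b) v - Gf n b v| ≤ Dvec D a 3 / (n : ℝ) ^ 3) ∧
    (∀ n : ℕ, 2 ≤ n → ∀ b ∈ Bset n, ∀ v,
      |(Gf n b (v + unitVec μ + unitVec ν) - gFree (v + unitVec μ + unitVec ν))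
          - (Gf n b (v + unitVec μ) - gFree (v + unitVec μ))
          - ((Gf n (sh n b) (v + unitVec ν) - gFree (v + unitVec ν)) - (Gf n (sh n b) v - gFree v))|
        ≤ Dvec D a 2 / (n : ℝ) ^ 4) := by
  obtain ⟨H0, H1, H1x, H2x⟩ :=
    hRows_of_gamma Mv a ha X₀ kk nn hφ Bset sh hX hk hν gT D h0S h1S h1xS h2xS
  exact ⟨h0_avg_vol hG hg H0, h1_avg_vol hG hg H1, h1x_vol hshB hG H1x, h2x_vol hshB hG hg H2x⟩

/-- **END-TO-END FOR THE VECTOR SMALL-FIELD LEGS, ANY INSTANCE** — the an4 seam's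
`endpointExistence_of_scalarBounds_avgFirst_vol` with its eight torus-side rows SUPPLIED for
`GT := VectorTailsPt.GT Mv a ha X₀ kk nn φ`: the four `d`-rows by `VectorTailsPt.wall_rows_mod`
(constants `δ, A` from the printed Props, by name), the four `h`-rows by
`VectorTailsWindow.hRows_of_gamma` from the Γ-part rows `h0S … h2xS` (constants `Dvec D a`).
Every other binder of the an4 theorem is carried VERBATIM.  [folklore] -/
theorem endpointExistence_of_vectorTails_vol
    (h12 : B5.Prop12Printed (fam (fun i : ℕ+ × τ => ((i.1 : ℕ+) : ℕ)) (fun i => i.1.pos) Mv a ha))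
    (h126 : B5.Kernel126_127Printed (kfam (fun i : ℕ+ × τ => ((i.1 : ℕ+) : ℕ)) Mv))
    {l : Filter τ} [l.NeBot]
    (hgrow : ∀ (m : ℕ+) (ρ : Fin 4), Tendsto (fun t => (m : ℕ) * Mv (m, t) ρ) l atTop)
    (X₀ : (i : ℕ+ × τ) → κB → Tor (fine ((i.1 : ℕ+) : ℕ) (Mv i))) (kk nn : ℕ → κB → Fin 4)
    (φ : ℂ →+ ℝ) (hφ : ∀ z, |φ z| ≤ ‖z‖) {Bset : ℕ → Finset κB} {sh : ℕ → Equiv.Perm κB}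
    {μ ν : Fin 4}
    (hX : ∀ (m : ℕ+) (t : τ), ∀ b ∈ Bset m,
      X₀ (m, t) (sh m b) - (X₀ (m, t) b + B5Prop11Plancherel.unitVec (fine (m : ℕ) (Mv (m, t))) μ)
        ∈ blockSteps (m : ℕ) (Mv (m, t)))
    (hk : ∀ m : ℕ, ∀ b ∈ Bset m, kk m (sh m b) = kk m b)
    (hν : ∀ m : ℕ, ∀ b ∈ Bset m, nn m (sh m b) = nn m b)
    (hshB : ∀ n : ℕ, 2 ≤ n → ∀ b, sh n b ∈ Bset n ↔ b ∈ Bset n)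
    {β : HBeta} {Cn : B12.Construction} (hgen : ForwardGenerated Cn β)
    (S : B12Beta.OneLoopSplit β) (hμν : μ ≠ ν) {N : ℝ} (hN : N ≠ 0)
    {Lc : ℕ} (hL : 2 ≤ Lc) {μC : ℕ → ℕ → ℝ} {wt : ℕ → κB → ℝ}
    {gT : ℕ → κB → τ → Pt → ℝ} {Gf : ℕ → κB → Pt → ℝ} {D : ℕ → ℝ} (hD : ∀ j, 0 ≤ D j)
    {U cc : ℝ} {M : ℕ → ℕ}
    (hwt0 : ∀ n : ℕ, 2 ≤ n → ∀ b ∈ Bset n, 0 ≤ wt n b) (hwt1 : ∀ n : ℕ, 2 ≤ n → ∑ b ∈ Bset n, wt n b = 1)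
    (hwtsh : ∀ n : ℕ, 2 ≤ n → ∀ b ∈ Bset n, wt n (sh n b) = wt n b)
    (hc : 1 ≤ cc) (hM : ∀ L : ℕ, 2 ≤ L → 1 ≤ M L ∧ (L : ℝ) ≤ cc * M L) (hML : ∀ L : ℕ, 2 ≤ L → M L ≤ L)
    (hG : ∀ n : ℕ, 2 ≤ n → ∀ b ∈ Bset n, ∀ v,
      Tendsto (fun t => GT Mv a ha X₀ kk nn φ n b t v) l (𝓝 (Gf n b v)))
    (hg : ∀ n : ℕ, 2 ≤ n → ∀ b ∈ Bset n, ∀ v, Tendsto (fun t => gT n b t v) l (𝓝 (gFree v)))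
    (h0S : ∀ n : ℕ, 2 ≤ n → ∀ b ∈ Bset n, ∀ v, ∀ᶠ t in l,
      |GS Mv a X₀ kk nn φ n b t v - gT n b t v| ≤ D 0 / (n : ℝ) ^ 2)
    (h1S : ∀ n : ℕ, 2 ≤ n → ∀ b ∈ Bset n, ∀ v (ρ : Fin 4), ∀ᶠ t in l,
      |(GS Mv a X₀ kk nn φ n b t (v + unitVec ρ) - gT n b t (v + unitVec ρ))
          - (GS Mv a X₀ kk nn φ n b t v - gT n b t v)| ≤ D 1 / (n : ℝ) ^ 3)
    (h1xS : ∀ n : ℕ, 2 ≤ n → ∀ b ∈ Bset n, ∀ v, ∀ᶠ t in l,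
      |GS Mv a X₀ kk nn φ n (sh n b) t v - GS Mv a X₀ kk nn φ n b t v| ≤ D 3 / (n : ℝ) ^ 3)
    (h2xS : ∀ n : ℕ, 2 ≤ n → ∀ b ∈ Bset n, ∀ v, ∀ᶠ t in l,
      |(GS Mv a X₀ kk nn φ n b t (v + unitVec μ + unitVec ν) - gT n b t (v + unitVec μ + unitVec ν))
          - (GS Mv a X₀ kk nn φ n b t (v + unitVec μ) - gT n b t (v + unitVec μ))
          - ((GS Mv a X₀ kk nn φ n (sh n b) t (v + unitVec ν) - gT n (sh n b) t (v + unitVec ν))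
            - (GS Mv a X₀ kk nn φ n (sh n b) t v - gT n (sh n b) t v))| ≤ D 2 / (n : ℝ) ^ 4)
    (hU : ∀ m : ℕ, 1 ≤ m →
      |composedCoeff μC m - ∑ b ∈ Bset (Lc ^ m), wt (Lc ^ m) b * fullSum (stK μ ν N (Gf (Lc ^ m) b))| ≤ U)
    (hid : IdentityForm μC S.β0)
    {rr γ₀ β' : ℝ} (hγ₀ : 0 < γ₀) (hrem : RemainderConst S γ₀ rr) (hr : rr ≤ B12Normalization.stepBal N Lc)
    (hβ' : 0 ≤ β') (hcont : BetaContH γ₀ β) (hup : BetaUpperH β' γ₀ β) : EndpointExistence Cn := by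
  obtain ⟨δ, A, hδ, hA, d0T, d1T, d1xT, d2xT⟩ :=
    wall_rows_mod Mv a ha h12 h126 hgrow X₀ kk nn φ hφ Bset sh (μ := μ) (ν := ν) hX hk hν
  obtain ⟨H0, H1, H1x, H2x⟩ :=
    hRows_of_gamma Mv a ha X₀ kk nn hφ Bset sh hX hk hν gT D h0S h1S h1xS h2xS
  exact endpointExistence_of_scalarBounds_avgFirst_vol hgen S hμν hN hL (Dvec_nonneg hD ha) hA hδ
    hwt0 hwt1 hshB hwtsh hc hM hML hG hg H0 H1 H1x H2x d0T d1T d1xT d2xT hU hid hγ₀ hrem hr hβ'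
    hcont hup

end Generic

/-! ## §2 The labelled cyclic block instance (`Beta/VectorTailsBlock`) -/

section BlockInstance

variable {τ : Type} {L : Type*} (Mv : ℕ+ × τ → Fin 4 → ℕ) [hMv : ∀ i ρ, NeZero (Mv i ρ)]
  (a : ℝ) (ha : 0 < a)

/-- **END-TO-END FOR THE VECTOR LEGS ON THE LABELLED CYCLIC BLOCK INSTANCE**: base points
`(b, ℓ) ∈ [0,n)⁴ × SL`, instance map `X₀L` (= `castT` of the integer point), shift `lshift n μ`,
components `kk n (b, ℓ) = k ℓ`, `nn n (b, ℓ) = ν₀ ℓ`; the instance hypotheses hX-mod / hk / hν /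
hshB of §1 are DISCHARGED (`lwrapped_hX`, `rfl`, `rfl`, `lshift_mem_lblock_iff`).  The weights
`wt` with their three binders stay the wall's (see §3 for the uniform choice).  [folklore] -/
theorem endpointExistence_of_vectorTails_block
    (h12 : B5.Prop12Printed (fam (fun i : ℕ+ × τ => ((i.1 : ℕ+) : ℕ)) (fun i => i.1.pos) Mv a ha))
    (h126 : B5.Kernel126_127Printed (kfam (fun i : ℕ+ × τ => ((i.1 : ℕ+) : ℕ)) Mv))
    {l : Filter τ} [l.NeBot]
    (hgrow : ∀ (m : ℕ+) (ρ : Fin 4), Tendsto (fun t => (m : ℕ) * Mv (m, t) ρ) l atTop)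
    (SL : Finset L) (k ν₀ : L → Fin 4) (φ : ℂ →+ ℝ) (hφ : ∀ z, |φ z| ≤ ‖z‖) {μ ν : Fin 4}
    {β : HBeta} {Cn : B12.Construction} (hgen : ForwardGenerated Cn β)
    (S : B12Beta.OneLoopSplit β) (hμν : μ ≠ ν) {N : ℝ} (hN : N ≠ 0)
    {Lc : ℕ} (hL : 2 ≤ Lc) {μC : ℕ → ℕ → ℝ} {wt : ℕ → Pt × L → ℝ}
    {gT : ℕ → Pt × L → τ → Pt → ℝ} {Gf : ℕ → Pt × L → Pt → ℝ} {D : ℕ → ℝ} (hD : ∀ j, 0 ≤ D j)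
    {U cc : ℝ} {M : ℕ → ℕ}
    (hwt0 : ∀ n : ℕ, 2 ≤ n → ∀ b ∈ lblock SL n, 0 ≤ wt n b)
    (hwt1 : ∀ n : ℕ, 2 ≤ n → ∑ b ∈ lblock SL n, wt n b = 1)
    (hwtsh : ∀ n : ℕ, 2 ≤ n → ∀ b ∈ lblock SL n, wt n (lshift n μ b) = wt n b)
    (hc : 1 ≤ cc) (hM : ∀ L : ℕ, 2 ≤ L → 1 ≤ M L ∧ (L : ℝ) ≤ cc * M L) (hML : ∀ L : ℕ, 2 ≤ L → M L ≤ L)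
    (hG : ∀ n : ℕ, 2 ≤ n → ∀ b ∈ lblock SL n, ∀ v,
      Tendsto (fun t => GT Mv a ha (X₀L Mv) (fun _ b => k b.2) (fun _ b => ν₀ b.2) φ n b t v) l
        (𝓝 (Gf n b v)))
    (hg : ∀ n : ℕ, 2 ≤ n → ∀ b ∈ lblock SL n, ∀ v, Tendsto (fun t => gT n b t v) l (𝓝 (gFree v)))
    (h0S : ∀ n : ℕ, 2 ≤ n → ∀ b ∈ lblock SL n, ∀ v, ∀ᶠ t in l,
      |GS Mv a (X₀L Mv) (fun _ b => k b.2) (fun _ b => ν₀ b.2) φ n b t v - gT n b t v| ≤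
        D 0 / (n : ℝ) ^ 2)
    (h1S : ∀ n : ℕ, 2 ≤ n → ∀ b ∈ lblock SL n, ∀ v (ρ : Fin 4), ∀ᶠ t in l,
      |(GS Mv a (X₀L Mv) (fun _ b => k b.2) (fun _ b => ν₀ b.2) φ n b t (v + unitVec ρ)
            - gT n b t (v + unitVec ρ))
          - (GS Mv a (X₀L Mv) (fun _ b => k b.2) (fun _ b => ν₀ b.2) φ n b t v - gT n b t v)| ≤
        D 1 / (n : ℝ) ^ 3)
    (h1xS : ∀ n : ℕ, 2 ≤ n → ∀ b ∈ lblock SL n, ∀ v, ∀ᶠ t in l,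
      |GS Mv a (X₀L Mv) (fun _ b => k b.2) (fun _ b => ν₀ b.2) φ n (lshift n μ b) t v
          - GS Mv a (X₀L Mv) (fun _ b => k b.2) (fun _ b => ν₀ b.2) φ n b t v| ≤ D 3 / (n : ℝ) ^ 3)
    (h2xS : ∀ n : ℕ, 2 ≤ n → ∀ b ∈ lblock SL n, ∀ v, ∀ᶠ t in l,
      |(GS Mv a (X₀L Mv) (fun _ b => k b.2) (fun _ b => ν₀ b.2) φ n b t (v + unitVec μ + unitVec ν)
            - gT n b t (v + unitVec μ + unitVec ν))
          - (GS Mv a (X₀L Mv) (fun _ b => k b.2) (fun _ b => ν₀ b.2) φ n b t (v + unitVec μ)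
            - gT n b t (v + unitVec μ))
          - ((GS Mv a (X₀L Mv) (fun _ b => k b.2) (fun _ b => ν₀ b.2) φ n (lshift n μ b) t
                (v + unitVec ν) - gT n (lshift n μ b) t (v + unitVec ν))
            - (GS Mv a (X₀L Mv) (fun _ b => k b.2) (fun _ b => ν₀ b.2) φ n (lshift n μ b) t v
              - gT n (lshift n μ b) t v))| ≤ D 2 / (n : ℝ) ^ 4)
    (hU : ∀ m : ℕ, 1 ≤ m →
      |composedCoeff μC m -
          ∑ b ∈ lblock SL (Lc ^ m), wt (Lc ^ m) b * fullSum (stK μ ν N (Gf (Lc ^ m) b))| ≤ U)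
    (hid : IdentityForm μC S.β0)
    {rr γ₀ β' : ℝ} (hγ₀ : 0 < γ₀) (hrem : RemainderConst S γ₀ rr) (hr : rr ≤ B12Normalization.stepBal N Lc)
    (hβ' : 0 ≤ β') (hcont : BetaContH γ₀ β) (hup : BetaUpperH β' γ₀ β) : EndpointExistence Cn :=
  endpointExistence_of_vectorTails_vol Mv a ha h12 h126 hgrow (X₀L Mv) (fun _ b => k b.2)
    (fun _ b => ν₀ b.2) φ hφ (Bset := lblock SL) (sh := fun n => lshift n μ) (lwrapped_hX Mv SL μ)
    (fun _ _ _ => rfl) (fun _ _ _ => rfl) (fun n _ b => lshift_mem_lblock_iff SL n μ b) hgen S hμν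
    hN hL hD hwt0 hwt1 hwtsh hc hM hML hG hg h0S h1S h1xS h2xS hU hid hγ₀ hrem hr hβ' hcont hup

end BlockInstance

/-! ## §3 Uniform weights on the labelled block -/

section Uniform

variable {L : Type*}

/-- UNIFORM WEIGHTS on the labelled block `[0,n)⁴ × SL`: `uwt SL n b = 1 / |lblock SL n|`
(independent of `b`).  [folklore] -/
noncomputable def uwt (SL : Finset L) (n : ℕ) (_b : Pt × L) : ℝ := (((lblock SL n).card : ℕ) : ℝ)⁻¹

/-- [folklore] -/
theorem uwt_nonneg (SL : Finset L) (n : ℕ) (b : Pt × L) : 0 ≤ uwt SL n b := by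
  unfold uwt; positivity

/-- [folklore] -/
theorem uwt_shift (SL : Finset L) (n : ℕ) (μ : Fin 4) (b : Pt × L) :
    uwt SL n (lshift n μ b) = uwt SL n b := rfl

/-- the uniform weights sum to one on every nonempty labelled block.  [folklore] -/
theorem sum_uwt {SL : Finset L} (hSL : SL.Nonempty) (n : ℕ) (hn : 1 ≤ n) :
    ∑ b ∈ lblock SL n, uwt SL n b = 1 := by
  have hpos : 0 < (lblock SL n).card := Finset.card_pos.mpr (lblock_nonempty hSL n hn)
  have hne : (((lblock SL n).card : ℕ) : ℝ) ≠ 0 := by exact_mod_cast hpos.ne'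
  simp only [uwt, Finset.sum_const, nsmul_eq_mul]
  exact mul_inv_cancel₀ hne

variable {τ : Type} (Mv : ℕ+ × τ → Fin 4 → ℕ) [hMv : ∀ i ρ, NeZero (Mv i ρ)] (a : ℝ) (ha : 0 < a)

/-- **END-TO-END FOR THE VECTOR LEGS ON THE LABELLED CYCLIC BLOCK WITH UNIFORM WEIGHTS** — §2
with `wt := uwt SL`: the three weight binders are discharged (`uwt_nonneg`, `sum_uwt`,
`uwt_shift`); what remains is exactly: the printed Props (h12, h126) BY NAME, the growth of the
volumes, the volume limits hG / hg, the Γ-part free-comparison rows, and the wall's one-loop data.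
[folklore] -/
theorem endpointExistence_of_vectorTails_uniformBlock
    (h12 : B5.Prop12Printed (fam (fun i : ℕ+ × τ => ((i.1 : ℕ+) : ℕ)) (fun i => i.1.pos) Mv a ha))
    (h126 : B5.Kernel126_127Printed (kfam (fun i : ℕ+ × τ => ((i.1 : ℕ+) : ℕ)) Mv))
    {l : Filter τ} [l.NeBot]
    (hgrow : ∀ (m : ℕ+) (ρ : Fin 4), Tendsto (fun t => (m : ℕ) * Mv (m, t) ρ) l atTop)
    {SL : Finset L} (hSL : SL.Nonempty) (k ν₀ : L → Fin 4) (φ : ℂ →+ ℝ) (hφ : ∀ z, |φ z| ≤ ‖z‖)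
    {μ ν : Fin 4}
    {β : HBeta} {Cn : B12.Construction} (hgen : ForwardGenerated Cn β)
    (S : B12Beta.OneLoopSplit β) (hμν : μ ≠ ν) {N : ℝ} (hN : N ≠ 0)
    {Lc : ℕ} (hL : 2 ≤ Lc) {μC : ℕ → ℕ → ℝ}
    {gT : ℕ → Pt × L → τ → Pt → ℝ} {Gf : ℕ → Pt × L → Pt → ℝ} {D : ℕ → ℝ} (hD : ∀ j, 0 ≤ D j)
    {U cc : ℝ} {M : ℕ → ℕ}
    (hc : 1 ≤ cc) (hM : ∀ L : ℕ, 2 ≤ L → 1 ≤ M L ∧ (L : ℝ) ≤ cc * M L) (hML : ∀ L : ℕ, 2 ≤ L → M L ≤ L)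
    (hG : ∀ n : ℕ, 2 ≤ n → ∀ b ∈ lblock SL n, ∀ v,
      Tendsto (fun t => GT Mv a ha (X₀L Mv) (fun _ b => k b.2) (fun _ b => ν₀ b.2) φ n b t v) l
        (𝓝 (Gf n b v)))
    (hg : ∀ n : ℕ, 2 ≤ n → ∀ b ∈ lblock SL n, ∀ v, Tendsto (fun t => gT n b t v) l (𝓝 (gFree v)))
    (h0S : ∀ n : ℕ, 2 ≤ n → ∀ b ∈ lblock SL n, ∀ v, ∀ᶠ t in l,
      |GS Mv a (X₀L Mv) (fun _ b => k b.2) (fun _ b => ν₀ b.2) φ n b t v - gT n b t v| ≤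
        D 0 / (n : ℝ) ^ 2)
    (h1S : ∀ n : ℕ, 2 ≤ n → ∀ b ∈ lblock SL n, ∀ v (ρ : Fin 4), ∀ᶠ t in l,
      |(GS Mv a (X₀L Mv) (fun _ b => k b.2) (fun _ b => ν₀ b.2) φ n b t (v + unitVec ρ)
            - gT n b t (v + unitVec ρ))
          - (GS Mv a (X₀L Mv) (fun _ b => k b.2) (fun _ b => ν₀ b.2) φ n b t v - gT n b t v)| ≤
        D 1 / (n : ℝ) ^ 3)
    (h1xS : ∀ n : ℕ, 2 ≤ n → ∀ b ∈ lblock SL n, ∀ v, ∀ᶠ t in l,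
      |GS Mv a (X₀L Mv) (fun _ b => k b.2) (fun _ b => ν₀ b.2) φ n (lshift n μ b) t v
          - GS Mv a (X₀L Mv) (fun _ b => k b.2) (fun _ b => ν₀ b.2) φ n b t v| ≤ D 3 / (n : ℝ) ^ 3)
    (h2xS : ∀ n : ℕ, 2 ≤ n → ∀ b ∈ lblock SL n, ∀ v, ∀ᶠ t in l,
      |(GS Mv a (X₀L Mv) (fun _ b => k b.2) (fun _ b => ν₀ b.2) φ n b t (v + unitVec μ + unitVec ν)
            - gT n b t (v + unitVec μ + unitVec ν))
          - (GS Mv a (X₀L Mv) (fun _ b => k b.2) (fun _ b => ν₀ b.2) φ n b t (v + unitVec μ)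
            - gT n b t (v + unitVec μ))
          - ((GS Mv a (X₀L Mv) (fun _ b => k b.2) (fun _ b => ν₀ b.2) φ n (lshift n μ b) t
                (v + unitVec ν) - gT n (lshift n μ b) t (v + unitVec ν))
            - (GS Mv a (X₀L Mv) (fun _ b => k b.2) (fun _ b => ν₀ b.2) φ n (lshift n μ b) t v
              - gT n (lshift n μ b) t v))| ≤ D 2 / (n : ℝ) ^ 4)
    (hU : ∀ m : ℕ, 1 ≤ m →
      |composedCoeff μC m -
          ∑ b ∈ lblock SL (Lc ^ m), uwt SL (Lc ^ m) b * fullSum (stK μ ν N (Gf (Lc ^ m) b))| ≤ U)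
    (hid : IdentityForm μC S.β0)
    {rr γ₀ β' : ℝ} (hγ₀ : 0 < γ₀) (hrem : RemainderConst S γ₀ rr) (hr : rr ≤ B12Normalization.stepBal N Lc)
    (hβ' : 0 ≤ β') (hcont : BetaContH γ₀ β) (hup : BetaUpperH β' γ₀ β) : EndpointExistence Cn :=
  endpointExistence_of_vectorTails_block Mv a ha h12 h126 hgrow SL k ν₀ φ hφ hgen S hμν hN hL hD
    (wt := uwt SL) (fun n _ b _ => uwt_nonneg SL n b) (fun n hn => sum_uwt hSL n (by omega))
    (fun n _ b _ => uwt_shift SL n μ b) hc hM hML hG hg h0S h1S h1xS h2xS hU hid hγ₀ hrem hr hβ'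
    hcont hup

end Uniform

end Literature.MathematicalPhysics.QuantumFieldTheory.Balaban1983to89.Beta.VectorTailsSeam
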